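import Mathlib.Analysis.SpecialFunctions.Log.Deriv
import Literature.Analysis.FluidPDE.LeraySelfSimilarCalculus
import Literature.Analysis.FluidPDE.SpaceTimeCalculus
import HarnessLib

/-!
# The similarity variables of Albritton–Brué–Colombo 2022: the ansatz
  `u(x,t) = t^{-1/2} U(x/√t, log t)` and the Navier–Stokes equations in similarity variables

Analysis/FluidPDE support file for the proof line of the named fact
`Literature.Analysis.FluidPDE.albritton_brue_colombo` (Albritton–Brué–Colombo, Ann. of Math.
196 (2022) = arXiv:2112.03116 [ABC], Thm. 1.2; `NSLerayHopf.lean`, `NSLerayHopfABCScaling.lean`).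
[ABC] construct their two Leray–Hopf solutions in the **similarity variables** (1.7)
`ξ = x/√t`, `τ = log t`, through the ansatz (1.8) `u(x,t) = t^{-1/2} U(ξ,τ)`,
`f(x,t) = t^{-3/2} F(ξ,τ)`, in which "(NS) become (1.9)":
`∂_τ U − ½(1 + ξ·∇_ξ)U − ΔU + U·∇U + ∇P = F`, `div U = 0`; the first solution is a steady state
`Ū` of (1.9) with the force profile (1.11) `F̄ := −½(1 + ξ·∇)Ū − ΔŪ + Ū·∇Ū`, the second is
`U = Ū + U^{lin} + U^{per}` (Thm. 1.3). This file vendors that dictionary for a general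
finite-dimensional inner product space `E` and PROVES the direction of the reduction the paper
uses — classical solutions of (1.9) are classical solutions of (NS) in physical variables:

* `AlbrittonBrueColombo2022.physVelocity U t x = (√t)⁻¹ • U (log t) ((√t)⁻¹ • x)`,
  `physPressure P t x = t⁻¹ * P (log t) ((√t)⁻¹ • x)` (the pressure scaling `[p] = L⁻²` of
  (1.5)–(1.6)), `physForce F t x = (√t)⁻³ • F (log t) ((√t)⁻¹ • x)` — (1.8), time first;
* the slice calculus (`fderiv_`/`convect_`/`divergence_`/`laplacian_physVelocity`,
  `gradient_physPressure`: every space derivative costs a factor `(√t)⁻¹`) and the time line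
  `hasDerivAt_physVelocity_time` / `timeDeriv_physVelocity`:
  `∂ₜu(t,x) = (√t)⁻³ (∂_τU − ½(U + DU(ξ)ξ))(log t, x/√t)` for `uncurry U` differentiable;
* joint smoothness of the ansatz on the physical slab (`isSmoothSpaceTimeOn_physVelocity`,
  `isSmoothSpaceTimeOn_physPressure`);
* `AlbrittonBrueColombo2022.IsSimilarityNSSolutionOn S F U P` — classical solutions of (1.9) on
  a set `S` of similarity times (the structure mirrors the accepted `IsClassicalNSSolutionOn`:
  joint smoothness of `U`, `P` on `S × E`, the momentum equation (1.9) with the one-sided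
  `timeDerivWithin S`, incompressibility), with the non-vacuity / steady case
  `IsSimilarityNSSolutionOn.steady` ((1.11): a smooth divergence-free `Ū` with `P = 0` solves
  (1.9) on `S = ℝ` with force `F̄`);
* **`IsSimilarityNSSolutionOn.isClassicalNSSolutionOn_phys`** — for OPEN `S`, a solution of
  (1.9) gives `IsClassicalNSSolutionOn {t > 0 | log t ∈ S} 1 (physForce F) (physVelocity U)
  (physPressure P)`; `…_phys_Iio`: `S = (−∞, τ₁)` ↦ physical times `(0, e^{τ₁})` (the solutions of
  Thm. 1.3 live on `ℝ³ × (0, e^T)`).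

## Design notes

* Conventions of [ABC]: viscosity `1`, rate `½` (`ξ = x/√t`), as printed; the tree's forward
  self-similar ansatz `lerayForward a U` (`SelfSimilar.lean`, `μ(t) = (2at)^{-1/2}`, STEADY
  profiles, unforced; Jia–Šverák 2014) is the case `a = ½`, `U` independent of `τ`, `F = 0` —
  not reused because here the profile depends on `τ = log t` and the system is forced; the
  dilation calculus of `LeraySelfSimilarCalculus.lean` (`fderiv_smul_comp_smul`, …) is reused.
  Bradshaw–Tsai's variables (`SimilarityVariables.lean`: `y = x/√(2t)`, `s = log √(2t)`) differ
  by constants and are tied to the time-periodic weak theory; not used here.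
* Junk values: for `t ≤ 0`, `√t = 0` and `(√t)⁻¹ = 0`, so `physVelocity U t = 0`,
  `physForce F t = 0` (and `physPressure P t = 0 · … = 0` as `t⁻¹ = 0` for `t = 0`); `log t` is
  Mathlib's junk-extended logarithm. Only `t > 0` is ever used (`0 < t` hypotheses), except that
  the junk value `physVelocity U 0 = 0` conveniently IS the datum `u₀ ≡ 0` of Thm. 1.2.
* Only the direction (1.9) ⟹ (NS) is proved (the one the construction uses); the converse is
  the same computation read backwards and is not needed.
* What is NOT here: the `L^p`-scalings (1.13)–(1.14) of the ansatz and the Leray–Hopf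
  verification (sequel file, on `ℝ³`, combining this file with
  `LerayHopfForcedOpenStripContinuity.lean`); the linearised operator `L_ss` (1.10) and
  Thm. 1.3 (a)–(b) themselves (the analytic core of [ABC]: Vishik's unstable vortex, §§2–4).

## Tree / Mathlib search

Tree: `lerayForward`, `IsForwardProfile`, `lerayForward_isClassical_iff_holds`,
`fderiv_smul_comp_smul`, `laplacian_smul_comp_smul`, `divergence_smul_comp_smul`,
`convect_smul_comp_smul`, `gradient_sq_mul_comp_smul_sub`, `hasDerivAt_lerayForwardScale`
(`LeraySelfSimilarCalculus`); `hasDerivAt_timeLine`, `hasFDerivAt_slice`,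
`IsSmoothSpaceTimeOn.contDiffAt` (`SpaceTimeCalculus`); `timeDerivWithin_of_mem_interior`
(`WeakSolution`); `BradshawTsai2017.physVelocity`, `simMap` (other conventions, not used).
Mathlib: `Real.hasDerivAt_sqrt`, `Real.hasDerivAt_log`, `Real.contDiffOn_log`,
`Real.log_lt_iff_lt_exp`, `HasDerivAt.smul`, `HasFDerivAt.comp_hasDerivAt`, `module`.

## References

* D. Albritton, E. Brué, M. Colombo, *Non-uniqueness of Leray solutions of the forced
  Navier–Stokes equations*, Ann. of Math. 196 (2022) 415–455 = arXiv:2112.03116, §1.1: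
  (1.5)–(1.6) (scaling), (1.7) (similarity variables), (1.8) (ansatz), (1.9) (NS in similarity
  variables), (1.11) (the force profile of a steady state), Thm. 1.3. [AlbrittonBrueColombo2022]
* H. Jia, V. Šverák, Invent. Math. 196 (2014), §1 (forward self-similar solutions
  `t^{-1/2}U(x/√t)`). [JiaSverak2014]
-/

noncomputable section

open MeasureTheory TopologicalSpace Set Function Filter Topology InnerProductSpace
open scoped RealInnerProductSpace NNReal Laplacian ContDiff

namespace Literature.Analysis.FluidPDE

/-! ### The scale factor `(√t)⁻¹` -/

section Scale

variable {t : ℝ}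

/-- `(√t)⁻¹ > 0` for `t > 0`. [folklore] -/
theorem sqrt_inv_pos (ht : 0 < t) : 0 < (Real.sqrt t)⁻¹ := inv_pos.2 (Real.sqrt_pos.2 ht)

/-- `((√t)⁻¹)² = t⁻¹` for `t > 0`. [folklore] -/
theorem sqrt_inv_sq (ht : 0 < t) : ((Real.sqrt t)⁻¹) ^ 2 = t⁻¹ := by
  rw [inv_pow, Real.sq_sqrt ht.le]

/-- **`d/dt (√t)⁻¹ = −½ (√t)⁻³`** for `t > 0`. [folklore] -/
theorem hasDerivAt_sqrt_inv (ht : 0 < t) :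
    HasDerivAt (fun s => (Real.sqrt s)⁻¹) (-(2⁻¹ * ((Real.sqrt t)⁻¹) ^ 3)) t := by
  have hne : Real.sqrt t ≠ 0 := (Real.sqrt_pos.2 ht).ne'
  have hinv := (Real.hasDerivAt_sqrt ht.ne').inv hne
  refine hinv.congr_deriv ?_
  rw [inv_pow]
  field_simp

/-- `(√·)⁻¹` is smooth on `(0, ∞)`. [folklore] -/
theorem contDiffOn_sqrt_inv {n : WithTop ℕ∞} : ContDiffOn ℝ n (fun s => (Real.sqrt s)⁻¹) (Ioi 0) :=
  (contDiffOn_id.sqrt fun _ hs => (ne_of_gt hs)).inv fun _ hs => (Real.sqrt_pos.2 hs).ne'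

end Scale

/-! ### The ansatz (1.8) of Albritton–Brué–Colombo -/

namespace AlbrittonBrueColombo2022

variable {E : Type*} [NormedAddCommGroup E] [InnerProductSpace ℝ E]

/-- **The velocity in physical variables** of a time-dependent similarity profile `U(τ, ξ)`
(Albritton–Brué–Colombo 2022, (1.7)–(1.8): `ξ = x/√t`, `τ = log t`,
`u(x, t) = t^{-1/2} U(ξ, τ)`): `physVelocity U t x = (√t)⁻¹ • U (log t) ((√t)⁻¹ • x)`. Time
first in both `U : ℝ → E → E` (`τ`, then `ξ`) and the result. Junk (`= 0`, as `√t = 0`) for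
`t ≤ 0`. [cite: AlbrittonBrueColombo2022, (1.7)–(1.8)] -/
def physVelocity (U : ℝ → E → E) : ℝ → E → E := fun t x =>
  (Real.sqrt t)⁻¹ • U (Real.log t) ((Real.sqrt t)⁻¹ • x)

/-- **The pressure in physical variables** of a similarity pressure profile `P(τ, ξ)`:
`p(x, t) = t⁻¹ P(ξ, τ)` (the scaling `[p] = L⁻²` of Albritton–Brué–Colombo 2022, (1.5)–(1.6),
in the variables (1.7)). Junk for `t ≤ 0`. [cite: AlbrittonBrueColombo2022, (1.5)–(1.8)] -/
def physPressure (P : ℝ → E → ℝ) : ℝ → E → ℝ := fun t x =>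
  t⁻¹ * P (Real.log t) ((Real.sqrt t)⁻¹ • x)

/-- **The force in physical variables** of a similarity force profile `F(τ, ξ)`
(Albritton–Brué–Colombo 2022, (1.8): `f(x, t) = t^{-3/2} F(ξ, τ)`):
`physForce F t x = (√t)⁻³ • F (log t) ((√t)⁻¹ • x)`. Junk (`= 0`) for `t ≤ 0`. [cite: AlbrittonBrueColombo2022, (1.8)] -/
def physForce (F : ℝ → E → E) : ℝ → E → E := fun t x =>
  ((Real.sqrt t)⁻¹) ^ 3 • F (Real.log t) ((Real.sqrt t)⁻¹ • x)

/-- Unfolding `physVelocity`. [cite: AlbrittonBrueColombo2022, (1.8)] -/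
@[simp]
theorem physVelocity_apply (U : ℝ → E → E) (t : ℝ) (x : E) :
    physVelocity U t x = (Real.sqrt t)⁻¹ • U (Real.log t) ((Real.sqrt t)⁻¹ • x) := rfl

/-- Unfolding `physPressure`. [cite: AlbrittonBrueColombo2022, (1.8)] -/
@[simp]
theorem physPressure_apply (P : ℝ → E → ℝ) (t : ℝ) (x : E) :
    physPressure P t x = t⁻¹ * P (Real.log t) ((Real.sqrt t)⁻¹ • x) := rfl

/-- Unfolding `physForce`. [cite: AlbrittonBrueColombo2022, (1.8)] -/
@[simp]
theorem physForce_apply (F : ℝ → E → E) (t : ℝ) (x : E) :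
    physForce F t x = ((Real.sqrt t)⁻¹) ^ 3 • F (Real.log t) ((Real.sqrt t)⁻¹ • x) := rfl

/-- The velocity slice is the dilation `x ↦ c • V(c • x)`, `c = (√t)⁻¹`, of the profile slice
`V = U(log t)`. [folklore] -/
theorem physVelocity_slice (U : ℝ → E → E) (t : ℝ) :
    physVelocity U t = fun x => (Real.sqrt t)⁻¹ • U (Real.log t) ((Real.sqrt t)⁻¹ • x) := rfl

/-! #### Slices: space derivatives scale like powers of `(√t)⁻¹` -/

/-- `D u(t) (x) = t⁻¹ • DU(τ)(ξ)` (as `((√t)⁻¹)²`), `ξ = x/√t`, `τ = log t`. [folklore] -/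
theorem fderiv_physVelocity (U : ℝ → E → E) (t : ℝ) (x : E) :
    fderiv ℝ (physVelocity U t) x =
      ((Real.sqrt t)⁻¹) ^ 2 • fderiv ℝ (U (Real.log t)) ((Real.sqrt t)⁻¹ • x) :=
  fderiv_smul_comp_smul (U (Real.log t)) _ x

/-- `(u·∇)u (t, x) = (√t)⁻³ • (U·∇)U (τ, ξ)`. [folklore] -/
theorem convect_physVelocity (U : ℝ → E → E) (t : ℝ) (x : E) :
    convect (physVelocity U t) (physVelocity U t) x =
      ((Real.sqrt t)⁻¹) ^ 3 • convect (U (Real.log t)) (U (Real.log t)) ((Real.sqrt t)⁻¹ • x) :=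
  convect_smul_comp_smul (U (Real.log t)) _ x

/-- `div u (t, x) = t⁻¹ div U (τ, ξ)`. [folklore] -/
theorem divergence_physVelocity (U : ℝ → E → E) (t : ℝ) (x : E) :
    VectorCalculus.divergence (physVelocity U t) x =
      ((Real.sqrt t)⁻¹) ^ 2 * VectorCalculus.divergence (U (Real.log t)) ((Real.sqrt t)⁻¹ • x) :=
  divergence_smul_comp_smul (U (Real.log t)) _ x

/-- Divergence-free profile slices give divergence-free velocity slices. [folklore] -/
theorem isDivFree_physVelocity {U : ℝ → E → E} {t : ℝ}
    (h : VectorCalculus.IsDivFree (U (Real.log t))) : VectorCalculus.IsDivFree (physVelocity U t) := by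
  intro x
  rw [divergence_physVelocity, h, mul_zero]

/-! #### The time line: `∂ₜu = (√t)⁻³ (∂_τ U − ½(U + ξ·∇U))` -/

/-- **The time derivative of the ansatz.** If `uncurry U` is differentiable at
`(τ, ξ) = (log t, x/√t)`, `t > 0`, then `s ↦ u(s, x)` has derivative
`(√t)⁻³ • (∂_τU − ½(U + DU(ξ)ξ))(τ, ξ)` at `t` (product rule with `((√t)⁻¹)' = −½(√t)⁻³`,
chain rule through `s ↦ (log s, x/√s)`, whose velocity is `(t⁻¹, −½(√t)⁻³ x)`; this is the
computation behind Albritton–Brué–Colombo 2022, (1.9)). [cite: AlbrittonBrueColombo2022, (1.7)–(1.9)] -/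
theorem hasDerivAt_physVelocity_time {U : ℝ → E → E} {t : ℝ} (ht : 0 < t) (x : E)
    (hU : DifferentiableAt ℝ (uncurry U) (Real.log t, (Real.sqrt t)⁻¹ • x)) :
    HasDerivAt (fun s => physVelocity U s x)
      (((Real.sqrt t)⁻¹) ^ 3 • (timeDeriv U (Real.log t) ((Real.sqrt t)⁻¹ • x) -
        (2⁻¹ : ℝ) • (U (Real.log t) ((Real.sqrt t)⁻¹ • x) +
          fderiv ℝ (U (Real.log t)) ((Real.sqrt t)⁻¹ • x) ((Real.sqrt t)⁻¹ • x)))) t := by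
  set c : ℝ → ℝ := fun s => (Real.sqrt s)⁻¹ with hc
  set τ : ℝ := Real.log t with hτ
  set ξ : E := c t • x with hξ
  set L := fderiv ℝ (uncurry U) (τ, ξ) with hL
  have hUL : HasFDerivAt (uncurry U) L (τ, ξ) := hU.hasFDerivAt
  have h1 : HasDerivAt c (-(2⁻¹ * c t ^ 3)) t := hasDerivAt_sqrt_inv ht
  have hγ : HasDerivAt (fun s => (Real.log s, c s • x)) (t⁻¹, (-(2⁻¹ * c t ^ 3)) • x) t :=
    (Real.hasDerivAt_log ht.ne').prodMk (h1.smul_const x)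
  have h2 : HasDerivAt (fun s => U (Real.log s) (c s • x)) (L (t⁻¹, (-(2⁻¹ * c t ^ 3)) • x)) t := by
    have := hUL.comp_hasDerivAt t hγ
    exact this
  have h3 := h1.smul h2
  have he : (fun s => physVelocity U s x) = fun s => c s • U (Real.log s) (c s • x) := rfl
  rw [he]
  refine h3.congr_deriv ?_
  -- identify the partial derivatives
  have hsplit : L (t⁻¹, (-(2⁻¹ * c t ^ 3)) • x) =
      t⁻¹ • L (1, 0) + (-(2⁻¹ * c t ^ 3)) • L (0, x) := by
    have : ((t⁻¹, (-(2⁻¹ * c t ^ 3)) • x) : ℝ × E) =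
        t⁻¹ • ((1 : ℝ), (0 : E)) + (-(2⁻¹ * c t ^ 3)) • ((0 : ℝ), x) := by
      ext <;> simp
    rw [this, map_add, map_smul, map_smul]
  have hA : L (1, 0) = timeDeriv U τ ξ := by
    rw [timeDeriv_apply, (hasDerivAt_timeLine hUL).deriv]
  have hC : L (0, x) = fderiv ℝ (U τ) ξ x := by
    rw [(hasFDerivAt_slice hUL).fderiv, ContinuousLinearMap.comp_apply,
      ContinuousLinearMap.inr_apply]
  rw [hsplit, hA, hC, ← sqrt_inv_sq ht, hξ, map_smul]
  simp only [hc]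
  module

/-- The two-sided time derivative of the ansatz for `t > 0`:
`∂ₜu(t, x) = (√t)⁻³ • (∂_τU − ½(U + DU(ξ)ξ))(log t, x/√t)`. [cite: AlbrittonBrueColombo2022, (1.7)–(1.9)] -/
theorem timeDeriv_physVelocity {U : ℝ → E → E} {t : ℝ} (ht : 0 < t) (x : E)
    (hU : DifferentiableAt ℝ (uncurry U) (Real.log t, (Real.sqrt t)⁻¹ • x)) :
    timeDeriv (physVelocity U) t x =
      ((Real.sqrt t)⁻¹) ^ 3 • (timeDeriv U (Real.log t) ((Real.sqrt t)⁻¹ • x) -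
        (2⁻¹ : ℝ) • (U (Real.log t) ((Real.sqrt t)⁻¹ • x) +
          fderiv ℝ (U (Real.log t)) ((Real.sqrt t)⁻¹ • x) ((Real.sqrt t)⁻¹ • x))) :=
  (hasDerivAt_physVelocity_time ht x hU).deriv

/-! #### Joint smoothness on the physical slab -/

/-- The set of physical times `t > 0` with `log t ∈ S`. [folklore] -/
theorem isOpen_Ioi_inter_log_preimage {S : Set ℝ} (hS : IsOpen S) :
    IsOpen (Ioi (0 : ℝ) ∩ Real.log ⁻¹' S) :=
  (Real.continuousOn_log.mono fun _ ht => ne_of_gt ht).isOpen_inter_preimage isOpen_Ioi hS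

/-- Joint smoothness of the ansatz: if `uncurry U` is `C^∞` on `S × E` then
`uncurry (physVelocity U)` is `C^∞` on `{t > 0, log t ∈ S} × E` (composition with the smooth map
`(t, x) ↦ (log t, x/√t)` and multiplication by the smooth factor `(√t)⁻¹`). [folklore] -/
theorem isSmoothSpaceTimeOn_physVelocity {S : Set ℝ} {U : ℝ → E → E}
    (hU : IsSmoothSpaceTimeOn S U) :
    IsSmoothSpaceTimeOn (Ioi (0 : ℝ) ∩ Real.log ⁻¹' S) (physVelocity U) := by
  set T : Set ℝ := Ioi (0 : ℝ) ∩ Real.log ⁻¹' S with hT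
  have hsub : T ×ˢ (univ : Set E) ⊆ Ioi 0 ×ˢ univ := prod_mono inter_subset_left Subset.rfl
  have hc : ContDiffOn ℝ ∞ (fun z : ℝ × E => (Real.sqrt z.1)⁻¹) (T ×ˢ univ) :=
    (contDiffOn_sqrt_inv.comp contDiff_fst.contDiffOn fun z hz => hz.1).mono hsub
  have hlog : ContDiffOn ℝ ∞ (fun z : ℝ × E => Real.log z.1) (T ×ˢ univ) :=
    (Real.contDiffOn_log.comp contDiff_fst.contDiffOn fun z hz => ne_of_gt hz.1).mono hsub
  have hg : ContDiffOn ℝ ∞ (fun z : ℝ × E => (Real.log z.1, (Real.sqrt z.1)⁻¹ • z.2)) (T ×ˢ univ) :=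
    hlog.prodMk (hc.smul contDiff_snd.contDiffOn)
  have hmaps : MapsTo (fun z : ℝ × E => (Real.log z.1, (Real.sqrt z.1)⁻¹ • z.2)) (T ×ˢ univ)
      (S ×ˢ univ) := fun z hz => mk_mem_prod hz.1.2 (mem_univ _)
  have hcomp : ContDiffOn ℝ ∞ (fun z : ℝ × E => uncurry U (Real.log z.1, (Real.sqrt z.1)⁻¹ • z.2))
      (T ×ˢ univ) := hU.comp hg hmaps
  exact hc.smul hcomp

/-- Joint smoothness of the pressure ansatz `t⁻¹ P(log t, x/√t)`. [folklore] -/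
theorem isSmoothSpaceTimeOn_physPressure {S : Set ℝ} {P : ℝ → E → ℝ}
    (hP : IsSmoothSpaceTimeOn S P) :
    IsSmoothSpaceTimeOn (Ioi (0 : ℝ) ∩ Real.log ⁻¹' S) (physPressure P) := by
  set T : Set ℝ := Ioi (0 : ℝ) ∩ Real.log ⁻¹' S with hT
  have hsub : T ×ˢ (univ : Set E) ⊆ Ioi 0 ×ˢ univ := prod_mono inter_subset_left Subset.rfl
  have hc : ContDiffOn ℝ ∞ (fun z : ℝ × E => (Real.sqrt z.1)⁻¹) (T ×ˢ univ) :=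
    (contDiffOn_sqrt_inv.comp contDiff_fst.contDiffOn fun z hz => hz.1).mono hsub
  have hinv : ContDiffOn ℝ ∞ (fun z : ℝ × E => z.1⁻¹) (T ×ˢ univ) :=
    contDiff_fst.contDiffOn.inv fun z hz => ne_of_gt hz.1.1
  have hlog : ContDiffOn ℝ ∞ (fun z : ℝ × E => Real.log z.1) (T ×ˢ univ) :=
    (Real.contDiffOn_log.comp contDiff_fst.contDiffOn fun z hz => ne_of_gt hz.1).mono hsub
  have hg : ContDiffOn ℝ ∞ (fun z : ℝ × E => (Real.log z.1, (Real.sqrt z.1)⁻¹ • z.2)) (T ×ˢ univ) :=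
    hlog.prodMk (hc.smul contDiff_snd.contDiffOn)
  have hmaps : MapsTo (fun z : ℝ × E => (Real.log z.1, (Real.sqrt z.1)⁻¹ • z.2)) (T ×ˢ univ)
      (S ×ˢ univ) := fun z hz => mk_mem_prod hz.1.2 (mem_univ _)
  have hcomp : ContDiffOn ℝ ∞ (fun z : ℝ × E => uncurry P (Real.log z.1, (Real.sqrt z.1)⁻¹ • z.2))
      (T ×ˢ univ) := hP.comp hg hmaps
  exact hinv.mul hcomp

/-! #### Second-order terms (finite dimension) -/

variable [FiniteDimensional ℝ E]

/-- `Δu (t, x) = (√t)⁻³ • ΔU (τ, ξ)` for a `C²` slice. [folklore] -/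
theorem laplacian_physVelocity {U : ℝ → E → E} {t : ℝ} (hU : ContDiff ℝ 2 (U (Real.log t)))
    (x : E) :
    (Δ (physVelocity U t)) x =
      ((Real.sqrt t)⁻¹) ^ 3 • (Δ (U (Real.log t))) ((Real.sqrt t)⁻¹ • x) :=
  laplacian_smul_comp_smul hU _ x

/-- `∇p (t, x) = (√t)⁻³ • ∇P (τ, ξ)` for `t > 0`. [folklore] -/
theorem gradient_physPressure (P : ℝ → E → ℝ) {t : ℝ} (ht : 0 < t) (x : E) :
    gradient (physPressure P t) x =
      ((Real.sqrt t)⁻¹) ^ 3 • gradient (P (Real.log t)) ((Real.sqrt t)⁻¹ • x) := by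
  have h : physPressure P t = fun y => ((Real.sqrt t)⁻¹) ^ 2 * (P (Real.log t)
      ((Real.sqrt t)⁻¹ • y) - 0) := by
    funext y
    rw [physPressure_apply, sub_zero, sqrt_inv_sq ht]
  rw [h]
  exact gradient_sq_mul_comp_smul_sub (P (Real.log t)) _ 0 x

/-! ### The Navier–Stokes equations in similarity variables, (1.9) -/

/-- **Classical solutions of the Navier–Stokes equations in similarity variables**
(Albritton–Brué–Colombo 2022, (1.9), viscosity `1`):
`∂_τ U − ½(1 + ξ·∇_ξ)U − ΔU + U·∇U + ∇P = F`, `div U = 0`, pointwise on `S × E` for a time set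
`S ⊆ ℝ` of similarity times `τ`, with `U`, `P` jointly `C^∞` on `S × E` (the structure mirrors
the accepted `IsClassicalNSSolutionOn`: smoothness of velocity and pressure, the momentum
equation with the one-sided `timeDerivWithin S`, incompressibility; `(ξ·∇)U = DU(ξ)ξ`). A steady
profile `Ū` with `P = 0` and `F = F̄ := −½(1 + ξ·∇)Ū − ΔŪ + Ū·∇Ū` is a solution on every `S`
((1.11) there). [cite: AlbrittonBrueColombo2022, (1.9)] -/
structure IsSimilarityNSSolutionOn (S : Set ℝ) (F U : ℝ → E → E) (P : ℝ → E → ℝ) : Prop where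
  /-- The velocity profile is jointly smooth on `S × E`. -/
  smooth_velocity : IsSmoothSpaceTimeOn S U
  /-- The pressure profile is jointly smooth on `S × E`. -/
  smooth_pressure : IsSmoothSpaceTimeOn S P
  /-- The momentum equation (1.9): `∂_τU − ½(U + DU(ξ)ξ) − ΔU + DU(ξ)(U ξ) + ∇P = F`. -/
  momentum : ∀ τ ∈ S, ∀ ξ,
    timeDerivWithin S U τ ξ - (2⁻¹ : ℝ) • (U τ ξ + fderiv ℝ (U τ) ξ ξ) - (Δ (U τ)) ξ +
      convect (U τ) (U τ) ξ + gradient (P τ) ξ = F τ ξ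
  /-- Incompressibility `div U(τ) = 0` for `τ ∈ S`. -/
  divFree : ∀ τ ∈ S, VectorCalculus.IsDivFree (U τ)

/-- **Non-vacuity / the steady case (1.11)**: a smooth divergence-free steady profile `Ū` with
zero pressure solves (1.9) on all of `ℝ` with the force profile
`F̄ = −½(1 + ξ·∇)Ū − ΔŪ + Ū·∇Ū` (Albritton–Brué–Colombo 2022, (1.11): "any smooth function of
space may be considered a steady solution of the PDE"). [cite: AlbrittonBrueColombo2022, (1.11)] -/
theorem IsSimilarityNSSolutionOn.steady {Ubar : E → E} (hU : ContDiff ℝ ∞ Ubar)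
    (hdiv : VectorCalculus.IsDivFree Ubar) :
    IsSimilarityNSSolutionOn (univ : Set ℝ)
      (fun _ ξ => -((2⁻¹ : ℝ) • (Ubar ξ + fderiv ℝ Ubar ξ ξ)) - (Δ Ubar) ξ + convect Ubar Ubar ξ)
      (fun _ => Ubar) (fun _ _ => (0 : ℝ)) where
  smooth_velocity := by
    change ContDiffOn ℝ ∞ (fun z : ℝ × E => Ubar z.2) (univ ×ˢ univ)
    exact (hU.comp contDiff_snd).contDiffOn
  smooth_pressure := by
    change ContDiffOn ℝ ∞ (fun _ : ℝ × E => (0 : ℝ)) (univ ×ˢ univ)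
    exact contDiffOn_const
  momentum τ _ ξ := by
    have h1 : timeDerivWithin (univ : Set ℝ) (fun _ : ℝ => Ubar) τ ξ = 0 := by
      rw [timeDerivWithin_apply, derivWithin_univ]
      exact deriv_const τ (Ubar ξ)
    have h2 : gradient (fun _ : E => (0 : ℝ)) ξ = 0 := by
      rw [gradient, fderiv_fun_const]; simp
    rw [h1, h2]
    abel
  divFree _ _ := hdiv

/-- **From similarity variables to physical variables** (Albritton–Brué–Colombo 2022, §1.1,
(1.7)–(1.9): "In these variables, the Navier–Stokes equations become (1.9)"; here the direction
used in the paper, solutions of (1.9) ⟹ solutions of (NS)). If `(U, P)` is a classical solution of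
the similarity system (1.9) with force profile `F` on an **open** set `S` of similarity times,
then `u = t^{-1/2}U(x/√t, log t)`, `p = t⁻¹P(x/√t, log t)` form a classical solution of the forced
Navier–Stokes system with viscosity `1` and force `f = t^{-3/2}F(x/√t, log t)` on the physical
times `{t > 0 : log t ∈ S}`: every term of (NS) at `(t, x)` is `(√t)⁻³` times the corresponding
term of (1.9) at `(log t, x/√t)` (`timeDeriv_physVelocity`, `convect_physVelocity`,
`laplacian_physVelocity`, `gradient_physPressure`). [cite: AlbrittonBrueColombo2022, §1.1 (1.7)–(1.9)] -/
theorem IsSimilarityNSSolutionOn.isClassicalNSSolutionOn_phys {S : Set ℝ} (hS : IsOpen S)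
    {F U : ℝ → E → E} {P : ℝ → E → ℝ} (h : IsSimilarityNSSolutionOn S F U P) :
    IsClassicalNSSolutionOn (Ioi (0 : ℝ) ∩ Real.log ⁻¹' S) 1 (physForce F) (physVelocity U)
      (physPressure P) where
  smooth_velocity := isSmoothSpaceTimeOn_physVelocity h.smooth_velocity
  smooth_pressure := isSmoothSpaceTimeOn_physPressure h.smooth_pressure
  momentum t ht x := by
    have hT : IsOpen (Ioi (0 : ℝ) ∩ Real.log ⁻¹' S) := isOpen_Ioi_inter_log_preimage hS
    have ht0 : 0 < t := ht.1
    have hτ : Real.log t ∈ S := ht.2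
    set c : ℝ := (Real.sqrt t)⁻¹ with hc
    set τ : ℝ := Real.log t with hτ_def
    set ξ : E := c • x with hξ
    have hUd : DifferentiableAt ℝ (uncurry U) (τ, ξ) :=
      (h.smooth_velocity.contDiffAt hS hτ ξ).differentiableAt (by simp)
    have hU2 : ContDiff ℝ 2 (U τ) := contDiff_infty.1 (h.smooth_velocity.contDiff_slice hτ) 2
    rw [timeDerivWithin_of_mem_interior (by rwa [hT.interior_eq]), timeDeriv_physVelocity ht0 x hUd,
      convect_physVelocity, laplacian_physVelocity hU2, gradient_physPressure P ht0, one_smul,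
      physForce_apply]
    simp only [← hc, ← hτ_def, ← hξ]
    have key := h.momentum τ hτ ξ
    rw [timeDerivWithin_of_mem_interior (by rwa [hS.interior_eq])] at key
    have key' : timeDeriv U τ ξ - (2⁻¹ : ℝ) • (U τ ξ + fderiv ℝ (U τ) ξ ξ) + convect (U τ) (U τ) ξ =
        (Δ (U τ)) ξ - gradient (P τ) ξ + F τ ξ := by
      rw [← key]
      abel
    rw [← smul_add, key', smul_add, smul_sub]
  divFree t ht := isDivFree_physVelocity (h.divFree _ ht.2)

/-- The physical times of the similarity times `τ < τ₁` are `0 < t < e^{τ₁}`. [folklore] -/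
theorem Ioi_inter_log_preimage_Iio (τ₁ : ℝ) :
    Ioi (0 : ℝ) ∩ Real.log ⁻¹' Iio τ₁ = Ioo 0 (Real.exp τ₁) := by
  ext t
  simp only [mem_inter_iff, mem_Ioi, mem_preimage, mem_Iio, mem_Ioo]
  constructor
  · rintro ⟨ht, hlt⟩
    exact ⟨ht, by rwa [Real.log_lt_iff_lt_exp ht] at hlt⟩
  · rintro ⟨ht, hlt⟩
    exact ⟨ht, by rwa [Real.log_lt_iff_lt_exp ht]⟩

/-- **The transport on `τ < τ₁`**: a classical solution of (1.9) on the similarity times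
`(−∞, τ₁)` gives a classical solution of the forced Navier–Stokes system (viscosity `1`) on the
physical times `(0, e^{τ₁})` (Albritton–Brué–Colombo 2022, §1.1 and Thm. 1.3: the solutions live on
`ℝ³ × (0, e^T)`). [cite: AlbrittonBrueColombo2022, §1.1 (1.7)–(1.9)] -/
theorem IsSimilarityNSSolutionOn.isClassicalNSSolutionOn_phys_Iio {τ₁ : ℝ} {F U : ℝ → E → E}
    {P : ℝ → E → ℝ} (h : IsSimilarityNSSolutionOn (Iio τ₁) F U P) :
    IsClassicalNSSolutionOn (Ioo 0 (Real.exp τ₁)) 1 (physForce F) (physVelocity U)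
      (physPressure P) := by
  rw [← Ioi_inter_log_preimage_Iio]
  exact h.isClassicalNSSolutionOn_phys isOpen_Iio

end AlbrittonBrueColombo2022

end Literature.Analysis.FluidPDE

end
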